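import Literature.MathematicalPhysics.QuantumLattice.TorusSectorGibbsMixture
import HarnessLib

/-!
# Thermal energy windows on a FILLING BOX for torus limits of canonical sector Gibbs states
# (the filling axis of a downfolded box at `T > 0`: what is uniform in the density, and what is not)

Topic `MathematicalPhysics/QuantumLattice` (family `hubbard`); companion of `TorusSectorGibbsMixture` (the
`T > 0` word shape of record: torus limits `ω` of the canonical Gibbs states on `(rectN n L, S^z = 0)`, with
the CUT row `e(t,t',U,n) ≤ e_Φ(ω)` and the N2′ CAP `e_Φ(ω) ≤ e(t,t',U,n) + 2·H_b(n/2)/β`) and of the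
`T = 0` filling-box files `HubbardFillingBoxEnergyBounds` / `HubbardFillingBoxChemicalPotentialCell`
(closed filling box `[n₁, n₂] ↦` certified cap / floor of the CONVEX `n ↦ e(t,t',U,n)` from point rows).
Written for the material-oracle pipeline, whose boxes carry a filling INTERVAL (doping `x ± δx`,
self-doping intervals).

HONEST STATEMENT OF THE FILLING AXIS AT `T > 0`. A thermal torus-limit word is a statement about the
class of limits at ONE density `n`; the canonical sector `rectN n L` is not a coupling of the
Hamiltonian, and nothing in the tree (or in the literature short of equivalence of ensembles plus
differentiability of the free energy) transports a state-dependent word from one density to another.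
What IS uniform on a filling box is every word assembled from `n`-uniform ingredients, and this file
records the basic one:

* (private helpers) the
  entropy constant `s_max(n) = 2·H_b(n/2)` of the N2′ cap is monotone on each side of half filling
  (Mathlib `Real.binEntropy_strictMonoOn` / `…_strictAntiOn`) and at most `2 log 2`;
* `IsTorusLimitOfMixture.meanEnergy_window_of_fillingBox`: `T = 0` box rows `lo ≤ e(x) ≤ hi` on
  `[n₁, n₂]` and `2H_b(x/2) ≤ S` on the box give `lo ≤ e_{Φ(t,t',U)}(ω) ≤ hi + S/β` for EVERY thermal
  torus limit at EVERY density of the box (`U ≥ 0`, `β > 0`, `0 ≤ n₁`, `n₂ < 2`); packaged for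
  hole-doped boxes (`n₂ ≤ 1`: `S = 2H_b(n₂/2)`, `…_holeDoped`), electron-doped boxes (`n₁ ≥ 1`:
  `S = 2H_b(n₁/2)`, `…_electronDoped`) and any box (`S = 2 log 2`, `…_log_four`).

* §3 `IsTorusLimitOfMixture.meanEnergy_le_of_cap_at_le_beta` / `cap_term_nonneg_of_le_beta` /
  `meanEnergy_le_of_fillingBox_cap_at_le_beta`: the energy-CAP CLASS `e_Φ(ω) ≤ u` of a window
  certificate (its `κ`-row) contains every thermal torus limit at every `β ≥ β⋆` and every density of
  the box under ONE booking `hi + S/β⋆ ≤ u` (the N2′ cap decreases with `β`) — the low-temperature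
  half-line word shape (`Set.Ici`) of `TorusSectorGibbsScaleBoxWords`.

The inputs `lo`, `hi` are exactly what `energyDensityTT'_ge_min_of_mem_Icc_left/right`,
`energyDensityTT'_ge_min_of_supportingLine` and `energyDensityTT'_le_max_of_mem_Icc` deliver from
certified point rows. Everything is PROVED; no definition, no named fact, no sorry.

## Tree search (cited, not restated)

`IsTorusLimitOfMixture.energyDensityTT'_le_meanEnergy_of_sectorGibbs`,
`IsTorusLimitOfMixture.meanEnergy_hubbardTTPrime_le_energyDensityTT'_add_binEntropy_div`
(`TorusSectorGibbsMixture`); Mathlib `Real.binEntropy_strictMonoOn`, `Real.binEntropy_strictAntiOn`,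
`Real.binEntropy_le_log_two`. `lean search 'fillingBox|Icc n' ∩ 'sectorGibbs'`: nothing at `T > 0`.

## References

* D. Ruelle, *Statistical Mechanics: Rigorous Results* (1969), §3.4 (canonical thermodynamic functions of
  quantum lattice systems; the ground-state energy density as an infimum over states). [cite: Ruelle1969, §3.4]
* R. B. Israel, *Convexity in the Theory of Lattice Gases* (1979), Lemma II.3.1 (finite-volume Gibbs
  variational principle: energy–entropy cap). [cite: Israel1979, Lemma II.3.1]
* J. Wang et al., Phys. Rev. X 14 (2024) 031006, §III (energy-constrained relaxations: every state of
  energy `≤ E_up` obeying the constraints satisfies the certified bound). [cite: WangEtAl2024, §III]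
-/

noncomputable section

namespace Literature.MathematicalPhysics.QuantumLattice

open Matrix Finset HubbardWave0 Literature.Probability.LatticeModels ThermodynamicLimit
open _root_.Filter
open scoped _root_.Topology ComplexOrder BigOperators

/-! ### §1 The entropy constant on a filling box

A material box carries a filling INTERVAL `n ∈ [n₁, n₂]`. At `T > 0` a thermal torus-limit word is a
statement about the class at ONE density; nothing transports between densities (the states need not be
continuous in `n`). What does hold uniformly on a filling box is every word built from `n`-uniform
ingredients: the CUT row `e(t,t',U,n) ≤ e_Φ(ω)` with a `T = 0` box floor
(`HubbardFillingBoxEnergyBounds`), and the N2′ CAP `e_Φ(ω) ≤ e(t,t',U,n) + 2·H_b(n/2)/β` with a `T = 0`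
box cap and the maximum of the entropy constant over the box (`H_b` is monotone on each side of `n = 1`). -/

/-- On the hole-doped side the entropy constant is monotone: `0 ≤ x ≤ y ≤ 1 ⇒ 2H_b(x/2) ≤ 2H_b(y/2)`
(`Real.binEntropy` increasing on `[0, 1/2]`). [folklore] -/
private theorem two_mul_binEntropy_half_le_of_le_of_le_one {x y : ℝ} (hx : 0 ≤ x) (hxy : x ≤ y) (hy : y ≤ 1) :
    2 * Real.binEntropy (x / 2) ≤ 2 * Real.binEntropy (y / 2) := by
  have hmono := Real.binEntropy_strictMonoOn.monotoneOn
  have hx' : x / 2 ∈ Set.Icc (0 : ℝ) 2⁻¹ := ⟨by linarith, by rw [inv_eq_one_div]; linarith⟩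
  have hy' : y / 2 ∈ Set.Icc (0 : ℝ) 2⁻¹ := ⟨by linarith, by rw [inv_eq_one_div]; linarith⟩
  have := hmono hx' hy' (by linarith)
  linarith

/-- On the electron-doped side: `1 ≤ y ≤ x ≤ 2 ⇒ 2H_b(x/2) ≤ 2H_b(y/2)` (`Real.binEntropy` decreasing on
`[1/2, 1]`). [folklore] -/
private theorem two_mul_binEntropy_half_le_of_one_le_of_le {x y : ℝ} (hy : 1 ≤ y) (hyx : y ≤ x) (hx : x ≤ 2) :
    2 * Real.binEntropy (x / 2) ≤ 2 * Real.binEntropy (y / 2) := by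
  have hanti := Real.binEntropy_strictAntiOn.antitoneOn
  have hx' : x / 2 ∈ Set.Icc (2⁻¹ : ℝ) 1 := ⟨by rw [inv_eq_one_div]; linarith, by linarith⟩
  have hy' : y / 2 ∈ Set.Icc (2⁻¹ : ℝ) 1 := ⟨by rw [inv_eq_one_div]; linarith, by linarith⟩
  have := hanti hy' hx' (by linarith)
  linarith

/-- Everywhere: `2H_b(x/2) ≤ 2 log 2 = log 4`. [folklore] -/
private theorem two_mul_binEntropy_half_le_two_mul_log_two (x : ℝ) :
    2 * Real.binEntropy (x / 2) ≤ 2 * Real.log 2 := by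
  have := Real.binEntropy_le_log_two (p := x / 2)
  linarith

/-! ### §2 Thermal energy windows on a filling box -/

namespace InfVolFermionState

/-- **Thermal energy window on a FILLING BOX.** Let `U ≥ 0`, `β > 0`, `0 ≤ n₁`, `n₂ < 2`, and suppose
`T = 0` box rows `lo ≤ e(t,t',U,x) ≤ hi` for all `x ∈ [n₁, n₂]` (filling-box cap/floor lemmas of
`HubbardFillingBoxEnergyBounds`) and an entropy constant `2H_b(x/2) ≤ S` on the box. Then EVERY thermal
torus limit `ω` of the canonical sector Gibbs states at ANY density `n ∈ [n₁, n₂]` (sides `Ls → ∞`)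
satisfies `lo ≤ e_{Φ(t,t',U)}(ω) ≤ hi + S/β` (CUT row + N2′ CAP, both uniform in `n`).
[cite: Ruelle1969, §3.4] [cite: Israel1979, Lemma II.3.1] -/
theorem IsTorusLimitOfMixture.meanEnergy_window_of_fillingBox (t t' : ℝ) {U : ℝ} (hU : 0 ≤ U)
    {n₁ n₂ : ℝ} (hn₁ : 0 ≤ n₁) (hn₂ : n₂ < 2) {β : ℝ} (hβ : 0 < β) {lo hi S : ℝ}
    (hlo : ∀ x ∈ Set.Icc n₁ n₂, lo ≤ energyDensityTT' t t' U x)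
    (hhi : ∀ x ∈ Set.Icc n₁ n₂, energyDensityTT' t t' U x ≤ hi)
    (hS : ∀ x ∈ Set.Icc n₁ n₂, 2 * Real.binEntropy (x / 2) ≤ S)
    {n : ℝ} (hn : n ∈ Set.Icc n₁ n₂) {ω : InfVolFermionState 2} {Ls : ℕ → ℕ}
    (h : ω.IsTorusLimitOfMixture (sectorGibbsCount n) (fun L => sectorGibbsWeightTT' β t t' U n L)
      (fun L => sectorGibbsVectorTT' t t' U n L) Ls)
    (hLs : Tendsto Ls atTop atTop) :
    lo ≤ ω.meanEnergy (hubbardTTPrimeFermionInteraction t t' U) 1 ∧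
      ω.meanEnergy (hubbardTTPrimeFermionInteraction t t' U) 1 ≤ hi + S / β := by
  have hn0 : 0 ≤ n := hn₁.trans hn.1
  have hn2 : n < 2 := hn.2.trans_lt hn₂
  refine ⟨(hlo n hn).trans (h.energyDensityTT'_le_meanEnergy_of_sectorGibbs t t' U hn0 hn2 β hLs t' hU),
    (h.meanEnergy_hubbardTTPrime_le_energyDensityTT'_add_binEntropy_div t t' hU hn0 hn2 hβ hLs).trans ?_⟩
  exact add_le_add (hhi n hn) (div_le_div_of_nonneg_right (hS n hn) hβ.le)

/-- **Hole-doped filling box** (`0 ≤ n₁ ≤ n₂ ≤ 1`, the cuprate side): the entropy constant is read at the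
upper end, `lo ≤ e_Φ(ω) ≤ hi + 2H_b(n₂/2)/β` for every thermal torus limit at every density of the box.
[cite: Ruelle1969, §3.4] [cite: Israel1979, Lemma II.3.1] -/
theorem IsTorusLimitOfMixture.meanEnergy_window_of_fillingBox_holeDoped (t t' : ℝ) {U : ℝ}
    (hU : 0 ≤ U) {n₁ n₂ : ℝ} (hn₁ : 0 ≤ n₁) (hn₂ : n₂ ≤ 1) {β : ℝ} (hβ : 0 < β) {lo hi : ℝ}
    (hlo : ∀ x ∈ Set.Icc n₁ n₂, lo ≤ energyDensityTT' t t' U x)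
    (hhi : ∀ x ∈ Set.Icc n₁ n₂, energyDensityTT' t t' U x ≤ hi)
    {n : ℝ} (hn : n ∈ Set.Icc n₁ n₂) {ω : InfVolFermionState 2} {Ls : ℕ → ℕ}
    (h : ω.IsTorusLimitOfMixture (sectorGibbsCount n) (fun L => sectorGibbsWeightTT' β t t' U n L)
      (fun L => sectorGibbsVectorTT' t t' U n L) Ls)
    (hLs : Tendsto Ls atTop atTop) :
    lo ≤ ω.meanEnergy (hubbardTTPrimeFermionInteraction t t' U) 1 ∧
      ω.meanEnergy (hubbardTTPrimeFermionInteraction t t' U) 1 ≤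
        hi + 2 * Real.binEntropy (n₂ / 2) / β :=
  h.meanEnergy_window_of_fillingBox t t' hU hn₁ (by linarith) hβ hlo hhi
    (fun x hx => two_mul_binEntropy_half_le_of_le_of_le_one (hn₁.trans hx.1) hx.2 hn₂) hn hLs

/-- **Electron-doped filling box** (`1 ≤ n₁ ≤ n₂ < 2`): the entropy constant is read at the lower end,
`lo ≤ e_Φ(ω) ≤ hi + 2H_b(n₁/2)/β`. [cite: Ruelle1969, §3.4] [cite: Israel1979, Lemma II.3.1] -/
theorem IsTorusLimitOfMixture.meanEnergy_window_of_fillingBox_electronDoped (t t' : ℝ) {U : ℝ}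
    (hU : 0 ≤ U) {n₁ n₂ : ℝ} (hn₁ : 1 ≤ n₁) (hn₂ : n₂ < 2) {β : ℝ} (hβ : 0 < β) {lo hi : ℝ}
    (hlo : ∀ x ∈ Set.Icc n₁ n₂, lo ≤ energyDensityTT' t t' U x)
    (hhi : ∀ x ∈ Set.Icc n₁ n₂, energyDensityTT' t t' U x ≤ hi)
    {n : ℝ} (hn : n ∈ Set.Icc n₁ n₂) {ω : InfVolFermionState 2} {Ls : ℕ → ℕ}
    (h : ω.IsTorusLimitOfMixture (sectorGibbsCount n) (fun L => sectorGibbsWeightTT' β t t' U n L)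
      (fun L => sectorGibbsVectorTT' t t' U n L) Ls)
    (hLs : Tendsto Ls atTop atTop) :
    lo ≤ ω.meanEnergy (hubbardTTPrimeFermionInteraction t t' U) 1 ∧
      ω.meanEnergy (hubbardTTPrimeFermionInteraction t t' U) 1 ≤
        hi + 2 * Real.binEntropy (n₁ / 2) / β :=
  h.meanEnergy_window_of_fillingBox t t' hU (by linarith) hn₂ hβ hlo hhi
    (fun x hx => two_mul_binEntropy_half_le_of_one_le_of_le hn₁ hx.1 (hx.2.trans hn₂.le)) hn hLs

/-- **Any filling box** (`0 ≤ n₁`, `n₂ < 2`): `lo ≤ e_Φ(ω) ≤ hi + (2 log 2)/β`.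
[cite: Ruelle1969, §3.4] [cite: Israel1979, Lemma II.3.1] -/
theorem IsTorusLimitOfMixture.meanEnergy_window_of_fillingBox_log_four (t t' : ℝ) {U : ℝ}
    (hU : 0 ≤ U) {n₁ n₂ : ℝ} (hn₁ : 0 ≤ n₁) (hn₂ : n₂ < 2) {β : ℝ} (hβ : 0 < β) {lo hi : ℝ}
    (hlo : ∀ x ∈ Set.Icc n₁ n₂, lo ≤ energyDensityTT' t t' U x)
    (hhi : ∀ x ∈ Set.Icc n₁ n₂, energyDensityTT' t t' U x ≤ hi)
    {n : ℝ} (hn : n ∈ Set.Icc n₁ n₂) {ω : InfVolFermionState 2} {Ls : ℕ → ℕ}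
    (h : ω.IsTorusLimitOfMixture (sectorGibbsCount n) (fun L => sectorGibbsWeightTT' β t t' U n L)
      (fun L => sectorGibbsVectorTT' t t' U n L) Ls)
    (hLs : Tendsto Ls atTop atTop) :
    lo ≤ ω.meanEnergy (hubbardTTPrimeFermionInteraction t t' U) 1 ∧
      ω.meanEnergy (hubbardTTPrimeFermionInteraction t t' U) 1 ≤ hi + 2 * Real.log 2 / β :=
  h.meanEnergy_window_of_fillingBox t t' hU hn₁ hn₂ hβ hlo hhi
    (fun x _ => two_mul_binEntropy_half_le_two_mul_log_two x) hn hLs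

/-! ### §3 Energy-cap class membership, uniform on a filling box × a low-temperature half-line

A `T = 0`-style window certificate with an energy-constraint row `κ·(u·1 − Γ E_Φ)` (`κ ≥ 0`) bounds the
objective in EVERY state `ω` of its null class with `e_Φ(ω) ≤ u` (the `κ`-term
`κ (u − e_Φ(ω))` of `re_expect_ge_of_window_certificate_TT'_ineq_of_nulls` /
`re_expect_ge_of_thermal_certificate_TT'_of_sectorGibbs` is then nonnegative and can be dropped).
Thermal torus limits enter that cap class through the N2′ cap, MONOTONICALLY in `β`: the bound
`e(n) + 2H_b(n/2)/β` decreases with `β`, so one booking `u ≥ hi + S/β⋆` covers every density of a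
filling box and every `β ≥ β⋆` — the `Set.Ici` word shape that the scale-box seam
`thermalWord_on_scaleBox_of_unit_Ici` (`TorusSectorGibbsScaleBoxWords`) consumes. -/

/-- **Thermal states are in the energy-cap class `e_Φ ≤ u` at every `β ≥ β⋆`** once
`e(t,t',U,n) + 2H_b(n/2)/β⋆ ≤ u` (`β⋆ > 0`, `U ≥ 0`, `0 ≤ n < 2`; N2′ cap + monotonicity in `β`).
[cite: Israel1979, Lemma II.3.1] [cite: Ruelle1969, §3.4] -/
theorem IsTorusLimitOfMixture.meanEnergy_le_of_cap_at_le_beta (t t' : ℝ) {U : ℝ} (hU : 0 ≤ U)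
    {n : ℝ} (hn0 : 0 ≤ n) (hn2 : n < 2) {βs β u : ℝ} (hβs : 0 < βs) (hle : βs ≤ β)
    (hu : energyDensityTT' t t' U n + 2 * Real.binEntropy (n / 2) / βs ≤ u)
    {ω : InfVolFermionState 2} {Ls : ℕ → ℕ}
    (h : ω.IsTorusLimitOfMixture (sectorGibbsCount n) (fun L => sectorGibbsWeightTT' β t t' U n L)
      (fun L => sectorGibbsVectorTT' t t' U n L) Ls)
    (hLs : Tendsto Ls atTop atTop) :
    ω.meanEnergy (hubbardTTPrimeFermionInteraction t t' U) 1 ≤ u := by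
  have hβ : 0 < β := hβs.trans_le hle
  have hcap := h.meanEnergy_hubbardTTPrime_le_energyDensityTT'_add_binEntropy_div t t' hU hn0 hn2 hβ hLs
  have hS : 0 ≤ 2 * Real.binEntropy (n / 2) := by
    have := Real.binEntropy_nonneg (p := n / 2) (by linarith) (by linarith)
    linarith
  have hmono : 2 * Real.binEntropy (n / 2) / β ≤ 2 * Real.binEntropy (n / 2) / βs :=
    div_le_div_of_nonneg_left hS hβs hle
  linarith

/-- The `κ`-term of an energy-constrained certificate is nonnegative for thermal states at every
`β ≥ β⋆`: `0 ≤ κ (u − e_Φ(ω))` (`κ ≥ 0`, booking `e(n) + 2H_b(n/2)/β⋆ ≤ u`).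
[cite: WangEtAl2024, §III] [cite: Israel1979, Lemma II.3.1] -/
theorem IsTorusLimitOfMixture.cap_term_nonneg_of_le_beta (t t' : ℝ) {U : ℝ} (hU : 0 ≤ U)
    {n : ℝ} (hn0 : 0 ≤ n) (hn2 : n < 2) {βs β u κ : ℝ} (hβs : 0 < βs) (hle : βs ≤ β) (hκ : 0 ≤ κ)
    (hu : energyDensityTT' t t' U n + 2 * Real.binEntropy (n / 2) / βs ≤ u)
    {ω : InfVolFermionState 2} {Ls : ℕ → ℕ}
    (h : ω.IsTorusLimitOfMixture (sectorGibbsCount n) (fun L => sectorGibbsWeightTT' β t t' U n L)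
      (fun L => sectorGibbsVectorTT' t t' U n L) Ls)
    (hLs : Tendsto Ls atTop atTop) :
    0 ≤ κ * (u - ω.meanEnergy (hubbardTTPrimeFermionInteraction t t' U) 1) :=
  mul_nonneg hκ (sub_nonneg.2 (h.meanEnergy_le_of_cap_at_le_beta t t' hU hn0 hn2 hβs hle hu hLs))

/-- **One booking for a whole filling box and all low temperatures.** With `T = 0` box caps
`e(t,t',U,x) ≤ hi` and an entropy constant `2H_b(x/2) ≤ S` on `[n₁, n₂]` (`0 ≤ n₁`, `n₂ < 2`), the booking
`hi + S/β⋆ ≤ u` (`β⋆ > 0`) puts EVERY thermal torus limit at EVERY density of the box and EVERY `β ≥ β⋆`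
in the cap class `e_Φ(ω) ≤ u`. [cite: Israel1979, Lemma II.3.1] [cite: Ruelle1969, §3.4] -/
theorem IsTorusLimitOfMixture.meanEnergy_le_of_fillingBox_cap_at_le_beta (t t' : ℝ) {U : ℝ}
    (hU : 0 ≤ U) {n₁ n₂ : ℝ} (hn₁ : 0 ≤ n₁) (hn₂ : n₂ < 2) {βs β u hi S : ℝ} (hβs : 0 < βs)
    (hle : βs ≤ β)
    (hhi : ∀ x ∈ Set.Icc n₁ n₂, energyDensityTT' t t' U x ≤ hi)
    (hS : ∀ x ∈ Set.Icc n₁ n₂, 2 * Real.binEntropy (x / 2) ≤ S) (hu : hi + S / βs ≤ u)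
    {n : ℝ} (hn : n ∈ Set.Icc n₁ n₂) {ω : InfVolFermionState 2} {Ls : ℕ → ℕ}
    (h : ω.IsTorusLimitOfMixture (sectorGibbsCount n) (fun L => sectorGibbsWeightTT' β t t' U n L)
      (fun L => sectorGibbsVectorTT' t t' U n L) Ls)
    (hLs : Tendsto Ls atTop atTop) :
    ω.meanEnergy (hubbardTTPrimeFermionInteraction t t' U) 1 ≤ u := by
  refine h.meanEnergy_le_of_cap_at_le_beta t t' hU (hn₁.trans hn.1) (hn.2.trans_lt hn₂) hβs hle ?_ hLs
  have h1 := hhi n hn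
  have h2 : 2 * Real.binEntropy (n / 2) / βs ≤ S / βs := div_le_div_of_nonneg_right (hS n hn) hβs.le
  linarith


end InfVolFermionState

end Literature.MathematicalPhysics.QuantumLattice

end
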